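import Summits.Ventures.YMGap.Thresholds.CouplingThirdDerivative
import HarnessLib

/-!
# Venture YMGap — C-DIFF3 (continuity half): the triple four-point sum is continuous in the coupling and the
# strong-coupling `SU(2)` state is `ContDiffOn ℝ 3` on `(0, β₁)`, `β₁ ≤ 9/25`

HONEST FRAMING: venture file of the cell `pub-ymgap` (QuantumFields programme), seat ds-1 (gen 10).  Strong-coupling LATTICE
statements (`SU(2)`, `d = 4`, Wilson action, one-sided vertex-star window); `C³` regularity of the unique DLR state in the
coupling, NOT analyticity; nothing about the continuum or the Clay problem.
* `su2_continuousOn_fourPoint` — each `β_W ↦ u₄(F; W_q; W_r; W_s)_{μ β_W}` is continuous on `[0, β₁]` along any DLR selection;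
* `su2_continuousOn_fourPointSum` — so is `β_W ↦ Σ_q Σ_r Σ_s u₄` (`continuousOn_tsum` three times, C-SUS4 domination);
* ★★ `su2_contDiffOn_three_integral_star` / `_9_25` — `β_W ↦ ⟨F⟩_{β_W}` is `ContDiffOn ℝ 3` on `Ioo 0 β₁` for every Lipschitz
  cylinder `F`; `su2_deriv_deriv_deriv_integral_eq` — `deriv³ ⟨F⟩ = Σ_q Σ_r Σ_s u₄` there.
-/

noncomputable section

open MeasureTheory ProbabilityTheory Function Finset Filter Topology Real Set
open scoped NNReal
open Literature.MathematicalPhysics.QuantumLattice (LGConfig ZdEdge ZdPlaquette plaquetteEdges fundamentalRep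
  ymGibbsMeasures)
open Literature.MathematicalPhysics.QuantumFieldTheory hiding ZdEdge
open Summit.Ventures.YMGap.DSWindow (starRate starRate_pos)
open Summit.Ventures.YMGap.StarWindowGauge (gaugeR gaugeR_lt_one_of_le)
open Summit.Ventures.YMGap.StarLemmaG (gaugeR_nonneg)
open Summit.Ventures.YMGap.RobustBall (l1 l1_sub_comm numOrient)
open Summit.Ventures.YMGap.LinearResponseBound (summable_and_tsum_base_le)

namespace Summit.Ventures.YMGap.CouplingResponse

/-- Local shorthand: the normalised plaquette observable `W_q = ½ Re tr U_q` of `SU(2)` on `ℤ⁴`. -/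
local notation3 (prettyPrint := false) "W∗" q:max =>
  zdPlaquetteObs (d := 4) (fundamentalRep (Fin 2)) (Prod.fst q) (Prod.snd q).1.1 (Prod.snd q).1.2

/-- Local shorthand: the connected three-point function `u₃(X; Y; Z)` under `μ`. -/
local notation3 (prettyPrint := false) "U₃[" X ";" Y ";" Z ";" μ "]" =>
  cov[fun ω => X ω * Y ω, Z; μ] - (∫ ω, X ω ∂μ) * cov[Y, Z; μ] - (∫ ω, Y ω ∂μ) * cov[X, Z; μ]

/-- Local shorthand: the connected four-point function in derivative form `u₄(X; Y; Z; W)` under `μ`. -/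
local notation3 (prettyPrint := false) "U₄[" X ";" Y ";" Z ";" W ";" μ "]" =>
  (cov[fun ω => (X ω * Y ω) * Z ω, W; μ] - (∫ ω, X ω * Y ω ∂μ) * cov[Z, W; μ] - (∫ ω, Z ω ∂μ) * cov[fun ω => X ω * Y ω, W; μ])
  - cov[X, W; μ] * cov[Y, Z; μ] - (∫ ω, X ω ∂μ) * U₃[Y ; Z ; W ; μ]
  - cov[Y, W; μ] * cov[X, Z; μ] - (∫ ω, Y ω ∂μ) * U₃[X ; Z ; W ; μ]

/-! ### §1 Continuity of the four-point function and of its triple sum -/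

section Continuity

/-- **Each four-point term is continuous in the coupling** on `[0, β₁]` along any DLR selection (products, means and covariances
of Lipschitz cylinders: `su2_continuousOn_threePoint`, `su2_continuousOn_cov_star`, `su2_continuousOn_integral`). -/
theorem su2_continuousOn_fourPoint {β₁ : ℝ} (h1 : β₁ ≤ 9 / 25)
    {μ : ℝ → Measure (LGConfig 4 (Matrix.specialUnitaryGroup (Fin 2) ℂ))}
    (hμ : ∀ βW ∈ Icc (0 : ℝ) β₁, μ βW ∈ ymGibbsMeasures (d := 4) (fundamentalRep (Fin 2)) (2 * (βW / 4)))
    {F : LGConfig 4 (Matrix.specialUnitaryGroup (Fin 2) ℂ) → ℝ} {Λ : Finset (ZdEdge 4)} {K : ℝ≥0}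
    (hF : IsLipschitzCylinder (fundamentalRep (Fin 2)) F Λ K)
    {x₀ : Literature.Probability.LatticeModels.Site 4} {D : ℕ} (hD : ∀ e ∈ Λ, ‖e.1 - x₀‖ ≤ D)
    (q r s : ZdPlaquette 4) :
    ContinuousOn (fun βW => U₄[F ; W∗ q ; W∗ r ; W∗ s ; μ βW]) (Icc (0 : ℝ) β₁) := by
  classical
  obtain ⟨hWq, -, hWq1, -, -⟩ := su2_plaquetteObs_data q
  obtain ⟨hWr, -, hWr1, -, -⟩ := su2_plaquetteObs_data r
  obtain ⟨hWs, -, hWs1, -, -⟩ := su2_plaquetteObs_data s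
  have hFM : ∀ U, |F U| ≤ ((⟨|F 1| + 2 * K, by positivity⟩ : ℝ≥0) : ℝ) := fun U => hF.abs_le U
  have hDq := plaquetteEdges_norm_sub_le q x₀
  have hDr := plaquetteEdges_norm_sub_le r x₀
  have hDs := plaquetteEdges_norm_sub_le s x₀
  have hFW := isLipschitzCylinder_mul hF hWq hFM hWq1
  have hDFW := union_norm_sub_le hD hDq
  have t1 := su2_continuousOn_threePoint h1 hμ hFW hDFW r s
  have cFs := su2_continuousOn_cov_star h1 hμ hF hWs hFM hWs1 hD hDs
  have cqr := su2_continuousOn_cov_star h1 hμ hWq hWr hWq1 hWr1 hDq hDr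
  have mF := su2_continuousOn_integral h1 hμ hF hD
  have t2 := su2_continuousOn_threePoint h1 hμ hWq hDq r s
  have cqs := su2_continuousOn_cov_star h1 hμ hWq hWs hWq1 hWs1 hDq hDs
  have cFr := su2_continuousOn_cov_star h1 hμ hF hWr hFM hWr1 hD hDr
  have mq := su2_continuousOn_integral h1 hμ hWq hDq
  have t3 := su2_continuousOn_threePoint h1 hμ hF hD r s
  exact (((t1.sub (cFs.mul cqr)).sub (mF.mul t2)).sub (cqs.mul cFr)).sub (mq.mul t3)

/-- **The triple four-point sum is continuous in the coupling** on `[0, β₁]` along any DLR selection: each term is continuous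
and the C-SUS4 domination `|u₄| ≤ A₄ ρ^{a_q} ρ^{a_r} ρ^{a_s}` is uniform on `[0, β₁]` (`continuousOn_tsum` three times). -/
theorem su2_continuousOn_fourPointSum {β₁ : ℝ} (h1 : β₁ ≤ 9 / 25)
    {μ : ℝ → Measure (LGConfig 4 (Matrix.specialUnitaryGroup (Fin 2) ℂ))}
    (hμ : ∀ βW ∈ Icc (0 : ℝ) β₁, μ βW ∈ ymGibbsMeasures (d := 4) (fundamentalRep (Fin 2)) (2 * (βW / 4)))
    {F : LGConfig 4 (Matrix.specialUnitaryGroup (Fin 2) ℂ) → ℝ} {Λ : Finset (ZdEdge 4)} {K : ℝ≥0}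
    (hF : IsLipschitzCylinder (fundamentalRep (Fin 2)) F Λ K)
    {x₀ : Literature.Probability.LatticeModels.Site 4} {D : ℕ} (hD : ∀ e ∈ Λ, ‖e.1 - x₀‖ ≤ D) :
    ContinuousOn (fun t => ∑' q : ZdPlaquette 4, ∑' r : ZdPlaquette 4, ∑' s : ZdPlaquette 4,
      U₄[F ; W∗ q ; W∗ r ; W∗ s ; μ t]) (Icc (0 : ℝ) β₁) := by
  classical
  rcases lt_or_ge β₁ 0 with hneg | hβ₁0
  · rw [Set.Icc_eq_empty (by simpa using hneg)]; exact continuousOn_empty _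
  have hκ : 0 < starRate (gaugeR β₁) :=
    starRate_pos (gaugeR_nonneg hβ₁0 (by linarith)) (gaugeR_lt_one_of_le hβ₁0 h1)
  set ρ : ℝ := Real.exp (-(starRate (gaugeR β₁) / 36)) with hρ
  set A : ℝ := 4 * (2 * Real.sqrt 2) ^ 2 * Real.exp (starRate (gaugeR β₁) * (D + 4)) *
    (40 * ((Λ.card : ℝ) + 4) ^ 2 * (|F 1| + 2 * K + 1) ^ 2 * ((K : ℝ) + 32) ^ 2) with hA
  set G : ℝ := numOrient 4 * ((1 + ρ) / (1 - ρ)) ^ 4 with hG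
  have hρ0 : 0 ≤ ρ := (Real.exp_pos _).le
  have hρ1 : ρ < 1 := Real.exp_lt_one_iff.2 (by linarith)
  have hK0 : (0 : ℝ) ≤ K := K.2
  have hA0 : 0 ≤ A := by positivity
  have hG0 : 0 ≤ G := by
    have : 0 < 1 - ρ := by linarith
    positivity
  have hc : 0 ≤ A * G ^ 2 := by positivity
  refine continuousOn_tsum (fun q => ?_) (summable_and_tsum_base_le (d := 4) hc hρ0 hρ1 x₀).1 (fun q t ht => ?_)
  · -- middle sum over `r`
    have hcq : 0 ≤ A * ρ ^ l1 (x₀ - q.1) * G := by positivity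
    refine continuousOn_tsum (fun r => ?_) (summable_and_tsum_base_le (d := 4) hcq hρ0 hρ1 x₀).1 (fun r t ht => ?_)
    · -- inner sum over `s`
      have hcqr : 0 ≤ A * ρ ^ l1 (x₀ - q.1) * ρ ^ l1 (x₀ - r.1) := by positivity
      refine continuousOn_tsum (fun s => su2_continuousOn_fourPoint h1 hμ hF hD q r s)
        (summable_and_tsum_base_le (d := 4) hcqr hρ0 hρ1 x₀).1 (fun s t ht => ?_)
      rw [Real.norm_eq_abs]
      have h := su2_abs_fourPoint_le h1 ht.1 ht.2 (hμ t ht) hF hD q r s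
      rw [← hρ, ← hA] at h
      exact h
    · obtain ⟨hs, hle⟩ := su2_summable_fourPoint h1 ht.1 ht.2 (hμ t ht) hF hD q r
      rw [← hρ, ← hA, ← hG] at hle
      refine (norm_tsum_le_tsum_norm hs.norm).trans ?_
      simp only [Real.norm_eq_abs]
      linarith
  · obtain ⟨hs, hle⟩ := su2_summable_fourPoint_two h1 ht.1 ht.2 (hμ t ht) hF hD q
    rw [← hρ, ← hA, ← hG] at hle
    refine (norm_tsum_le_tsum_norm hs).trans (hle.trans (le_of_eq ?_))
    ring

end Continuity

/-! ### §2 `C³` in the coupling -/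

section C3

/-- ★★ **`C³` IN THE COUPLING**: for `β₁ ≤ 9/25`, any DLR selection `μ` on `[0, β₁]` and every Lipschitz cylinder observable `F`,
`β_W ↦ ⟨F⟩_{μ β_W}` is `ContDiffOn ℝ 3` on `Ioo 0 β₁` — third derivative `Σ_q Σ_r Σ_s u₄` (`CouplingThirdDerivative`),
continuous by `su2_continuousOn_fourPointSum`. -/
theorem su2_contDiffOn_three_integral_star {β₁ : ℝ} (h1 : β₁ ≤ 9 / 25)
    {μ : ℝ → Measure (LGConfig 4 (Matrix.specialUnitaryGroup (Fin 2) ℂ))}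
    (hμ : ∀ βW ∈ Icc (0 : ℝ) β₁, μ βW ∈ ymGibbsMeasures (d := 4) (fundamentalRep (Fin 2)) (2 * (βW / 4)))
    {F : LGConfig 4 (Matrix.specialUnitaryGroup (Fin 2) ℂ) → ℝ} {Λ : Finset (ZdEdge 4)} {K : ℝ≥0}
    (hF : IsLipschitzCylinder (fundamentalRep (Fin 2)) F Λ K)
    {x₀ : Literature.Probability.LatticeModels.Site 4} {D : ℕ} (hD : ∀ e ∈ Λ, ‖e.1 - x₀‖ ≤ D) :
    ContDiffOn ℝ 3 (fun t => ∫ U, F U ∂(μ t)) (Ioo (0 : ℝ) β₁) := by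
  rw [show (3 : WithTop ℕ∞) = 2 + 1 from rfl, contDiffOn_succ_iff_deriv_of_isOpen isOpen_Ioo]
  refine ⟨fun t ht => (su2_hasDerivAt_integral_star h1 hμ hF hD ht).differentiableAt.differentiableWithinAt,
    fun h => absurd h (by simp), ?_⟩
  rw [show (2 : WithTop ℕ∞) = 1 + 1 from rfl, contDiffOn_succ_iff_deriv_of_isOpen isOpen_Ioo]
  refine ⟨fun t ht => (su2_hasDerivAt_deriv_integral_star h1 hμ hF hD ht).differentiableAt.differentiableWithinAt,
    fun h => absurd h (by simp), ?_⟩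
  exact contDiffOn_one_of_hasDerivAt (fun t ht => su2_hasDerivAt_deriv_deriv_integral_star h1 hμ hF hD ht)
    (su2_continuousOn_fourPointSum h1 hμ hF hD)

/-- **The third derivative, as an identity of functions on the open window**: for `0 < β_W < β₁`,
`deriv³ (t ↦ ⟨F⟩_{μ t}) β_W = Σ_q Σ_r Σ_s u₄(F; W_q; W_r; W_s)_{μ β_W}`. -/
theorem su2_deriv_deriv_deriv_integral_eq {β₁ : ℝ} (h1 : β₁ ≤ 9 / 25)
    {μ : ℝ → Measure (LGConfig 4 (Matrix.specialUnitaryGroup (Fin 2) ℂ))}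
    (hμ : ∀ βW ∈ Icc (0 : ℝ) β₁, μ βW ∈ ymGibbsMeasures (d := 4) (fundamentalRep (Fin 2)) (2 * (βW / 4)))
    {F : LGConfig 4 (Matrix.specialUnitaryGroup (Fin 2) ℂ) → ℝ} {Λ : Finset (ZdEdge 4)} {K : ℝ≥0}
    (hF : IsLipschitzCylinder (fundamentalRep (Fin 2)) F Λ K)
    {x₀ : Literature.Probability.LatticeModels.Site 4} {D : ℕ} (hD : ∀ e ∈ Λ, ‖e.1 - x₀‖ ≤ D)
    {βW : ℝ} (hb : βW ∈ Ioo (0 : ℝ) β₁) :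
    deriv (deriv (deriv fun t => ∫ U, F U ∂(μ t))) βW =
      ∑' q : ZdPlaquette 4, ∑' r : ZdPlaquette 4, ∑' s : ZdPlaquette 4, U₄[F ; W∗ q ; W∗ r ; W∗ s ; μ βW] :=
  (su2_hasDerivAt_deriv_deriv_integral_star h1 hμ hF hD hb).deriv

/-- **At the threshold `9/25`**: `β_W ↦ ⟨F⟩_{β_W}` is `ContDiffOn ℝ 3` on `(0, 9/25)` along the canonical selection. -/
theorem su2_contDiffOn_three_integral_9_25
    {μ : ℝ → Measure (LGConfig 4 (Matrix.specialUnitaryGroup (Fin 2) ℂ))}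
    (hμ : ∀ βW ∈ Icc (0 : ℝ) (9 / 25), μ βW ∈ ymGibbsMeasures (d := 4) (fundamentalRep (Fin 2)) (2 * (βW / 4)))
    {F : LGConfig 4 (Matrix.specialUnitaryGroup (Fin 2) ℂ) → ℝ} {Λ : Finset (ZdEdge 4)} {K : ℝ≥0}
    (hF : IsLipschitzCylinder (fundamentalRep (Fin 2)) F Λ K)
    {x₀ : Literature.Probability.LatticeModels.Site 4} {D : ℕ} (hD : ∀ e ∈ Λ, ‖e.1 - x₀‖ ≤ D) :
    ContDiffOn ℝ 3 (fun t => ∫ U, F U ∂(μ t)) (Ioo (0 : ℝ) (9 / 25)) :=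
  su2_contDiffOn_three_integral_star le_rfl hμ hF hD

end C3

end Summit.Ventures.YMGap.CouplingResponse

end
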